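import Summits.AtomisticToContinuum.Crystallization.Theorems.FiveFoldRation.Negative.CoreConclusionCubic

/-!
# Crux `DisclinationRation.FiveFoldRation` (stmt-AtomisticToContinuum-15799), line `Sketch` —
# hypothesis anatomy of the one open stub `stub_dr5_core` (cdisprove seat, cycle 2; Negative/ lane)

The open core stub of the registered skeleton (v6) reads
`∀ δ > 0, ∀ S, IsAdmissible δ S → FrontEnd S → LayerInequality S`.
Kernel-checked facts about the ROLE of each hypothesis (information for the lead and for planners; no statement of
the route is asserted positively):

* `core_iff_dropFrontEnd` — `FrontEnd S` is implied by admissibility (landed glue `frontEnd_of_isAdmissible`), so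
  the stub is the crux-strength statement `IsAdmissible δ S → LayerInequality S`;
* `isAlphabetGood_of_hasColumns` — conversely the column structure `HasColumns S` of the front end already makes
  every site alphabet-good, so `core_iff_dropGood`: deleting `hgood` from admissibility changes nothing either;
* `core_false_without_good` — but with BOTH `hgood` and the front end deleted the stub is FALSE: `ℤ³` is
  `1`-separated and relatively dense and violates `LayerInequality` (`not_layerInequality_cubic`, same lane).

(The remaining hypothesis `hsep` is load-bearing by an infinite witness — the scale-drifted decahedral rod, see
`Cruxes/FiveFoldRation/Disproof.lean` § (a″) — and `hdense` is believed to be decoration.)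
-/

noncomputable section

namespace Summit.AtomisticToContinuum.Crystallization.Theorems.FiveFoldRation.Negative

open Literature.Geometry.DiscreteGeometry
open Summit.AtomisticToContinuum.Crystallization.Theorems
open Summit.AtomisticToContinuum.Crystallization.Theorems.FiveFoldRation

/-- **The front-end hypothesis of the open core is implied by admissibility**: the stub
`IsAdmissible δ S → FrontEnd S → LayerInequality S` is equivalent to `IsAdmissible δ S → LayerInequality S`.
[folklore] -/
theorem core_iff_dropFrontEnd :
    (∀ δ : ℝ, 0 < δ → ∀ S : Set E3, IsAdmissible δ S → FrontEnd S → LayerInequality S) ↔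
      ∀ δ : ℝ, 0 < δ → ∀ S : Set E3, IsAdmissible δ S → LayerInequality S :=
  ⟨fun h δ hδ S hS => h δ hδ S hS (frontEnd_of_isAdmissible hδ hS), fun h δ hδ S hS _ => h δ hδ S hS⟩

/-- **Columns force goodness**: if the axis sites of `S` are covered by pole-to-pole columns carrying decahedral
matchings (`HasColumns S`), then every site of `S` is alphabet-good — a non-axis site is {fcc,hcp}-good by the
definition of `axisSites`, an axis site is decahedrally matched by clause (c3) of `HasColumns`. [folklore] -/
theorem isAlphabetGood_of_hasColumns {S : Set E3} (h : HasColumns S) : ∀ y ∈ S, IsAlphabetGood S y := by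
  intro y hy
  by_cases hg : IsFccHcpGood S y
  · exact hg.isAlphabetGood
  · obtain ⟨Γ, h1, -, h3⟩ := h
    obtain ⟨γ, hγ, n, rfl⟩ := h1 y ⟨hy, hg⟩
    obtain ⟨A, ⟨e, he⟩, -, -⟩ := h3 γ hγ n
    exact ⟨A, Or.inr (Or.inr ⟨e, he⟩)⟩

/-- The front end implies everywhere-goodness. [folklore] -/
theorem isAlphabetGood_of_frontEnd {S : Set E3} (h : FrontEnd S) : ∀ y ∈ S, IsAlphabetGood S y :=
  isAlphabetGood_of_hasColumns h.2.2.2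

/-- **Deleting `hgood` from admissibility changes nothing in the open core** (the front end re-supplies it).
[folklore] -/
theorem core_iff_dropGood :
    (∀ δ : ℝ, 0 < δ → ∀ S : Set E3, IsAdmissible δ S → FrontEnd S → LayerInequality S) ↔
      ∀ δ : ℝ, 0 < δ → ∀ S : Set E3, (∀ y ∈ S, ∀ z ∈ S, y ≠ z → δ ≤ dist y z) →
        (∃ R₁ : ℝ, ∀ p : E3, ∃ y ∈ S, dist y p ≤ R₁) → FrontEnd S → LayerInequality S :=
  ⟨fun h δ hδ S hsep hdense hF => h δ hδ S ⟨hsep, hdense, isAlphabetGood_of_frontEnd hF⟩ hF,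
    fun h δ hδ S hS hF => h δ hδ S hS.1 hS.2.1 hF⟩

/-- **Goodness in some form is load-bearing for the open core**: with both `hgood` and the front end deleted,
`∀ δ > 0, ∀ S, δ-separated → relatively dense → LayerInequality S` is FALSE — witness `ℤ³ = Set.range intVec`
(`cubic_separated`, `cubic_relDense`, `not_layerInequality_cubic`). [folklore] -/
theorem core_false_without_good :
    ¬ ∀ δ : ℝ, 0 < δ → ∀ S : Set E3, (∀ y ∈ S, ∀ z ∈ S, y ≠ z → δ ≤ dist y z) →
      (∃ R₁ : ℝ, ∀ p : E3, ∃ y ∈ S, dist y p ≤ R₁) → LayerInequality S := fun h =>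
  not_layerInequality_cubic (h 1 one_pos _ cubic_separated ⟨2, cubic_relDense⟩)

end Summit.AtomisticToContinuum.Crystallization.Theorems.FiveFoldRation.Negative

end
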